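import Summits.ValiantsHypothesis.ValiantsHypothesis.Theorems.KPlusLogSqLawLiftingRealDoubling
import Summits.ValiantsHypothesis.ValiantsHypothesis.Theorems.LacunarySymmetroidMatrixDescartesCensusFrame
import Summits.ValiantsHypothesis.ValiantsHypothesis.Theorems.LacunarySymmetroidMatrixDescartesCensusTropicalKLawBridges

/-!
# Route «KPlusLogSqLaw» — REAL STATIC NORMAL FORM: every lacunary pencil has the determinant of a STATIC one

HONEST FRAMING.  Helper bookkeeping for the OPEN crux `WeakLifting` (stmt-ValiantsHypothesis-19561, route `KPlusLogSqLaw`,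
cell `pub-symmetroid`; seat val-sym-lift-p4 g25, 2026-08-29) on the REAL side of its conclusion predicate `RealRootLawAt`.
Nothing here asserts `WeakLifting`, `TropicalB`, Conjecture B (`KPlusLogSqLaw`), `MatrixDescartes` (stmt-ValiantsHypothesis-18050)
or anything about VP ≠ VNP; no census register moves.

THE POINT.  Call a coefficient family `E : Fin K → Matrix _ _ R` STATIC if every entry position carries at most one exponent class
(`E l₁ x y ≠ 0 → E l₂ x y ≠ 0 → l₁ = l₂`), i.e. every entry of the pencil `∑ l, X ^ d l • E l` is a single signed monomial — the real
twin of the tropical static designs (`TropicalCensus.TropRootLawAtStatic`, `tropicalB_iff_staticDiagonal`).  By the Schur-complement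
linearisation `det [[1, B], [C, 0]] = det (−C·B)` with `B = [X^{d_l}·1]ₗ` (stacked) and `C = [−S_l]ₗ` (side by side), the determinant
of ANY `K`-term `m × m` pencil `∑ l, X^{d_l} S_l` over a commutative ring EQUALS the determinant of an explicit STATIC `(K+1)`-term pencil
of size `m·K + m` with exponents `(0, d)` (`det_linearization`, `exists_static_det_eq`).  Hence, row by row and with no hypothesis:
* `genRootLawAt_of_static` — static general rows of format `(m·K + m, K + 1)` bound the general row `GenRootLawAt m K`;
* `realRootLawAt_of_staticSymm` — static SYMMETRIC rows of format `((m·K+m) + (m·K+m), K + 1)` bound the symmetric row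
  `RealRootLawAt m K` (compose with the same-`K` doubling `[[0, P], [Pᵀ, 0]]` of `…LiftingRealDoubling`, which preserves staticity:
  `SD0_static`);
* `kPlusLogSqLaw_iff_staticSymm` — Conjecture B is EQUIVALENT to its restriction to static symmetric pencils (monomial-entry real
  symmetric matrices `(c_{ij} X^{e_{ij}})` with the `e_{ij}` drawn from `K` values): the determinant there is the signed matching
  polynomial `∑_σ sign σ · c_σ · X^{w(σ)}` of a `K`-slope-class assignment instance — the same combinatorial object whose parametric
  breakpoints the tropical half `TropicalB` counts.
[folklore] Schur complement / companion linearisation of polynomial matrices; symmetric doubling (Grenet–Kaltofen–Koiran–Portier,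
arXiv:1007.3804 §2).
-/

set_option linter.dupNamespace false
set_option autoImplicit false

namespace Summit.ValiantsHypothesis.ValiantsHypothesis.Theorems.KPlusLogSqLaw.RealStatic

open Summit.ValiantsHypothesis.ValiantsHypothesis.Theorems.LacunarySymmetroidMatrixDescartes (RealRootLawAt KPlusLogSqLaw)
open Summit.ValiantsHypothesis.ValiantsHypothesis.Theorems.LacunarySymmetroidMatrixDescartes.Census
  (realRootLawAt_mono realRootLawAt_descartes)
open Summit.ValiantsHypothesis.ValiantsHypothesis.Theorems.LacunarySymmetroidMatrixDescartes.TropicalCensus (realRootLawAt_zero)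
open Summit.ValiantsHypothesis.ValiantsHypothesis.Theorems.KPlusLogSqLaw.RealDoubling
  (GenRootLawAt SD0 BD0 SD0_isSymm card_roots_SD0 realRootLawAt_of_genRootLawAt)
open scoped BigOperators Matrix
open Polynomial

section Ring

variable {R : Type*} [CommRing R] {m K : ℕ}

/-- entries of `C · B` for the linearisation blocks: `(C·B) i j = −(∑ l, X^{d l} • (S l).map C) i j`. [folklore] -/
theorem linBlocks_mul_apply (d : Fin K → ℕ) (S : Fin K → Matrix (Fin m) (Fin m) R) (i j : Fin m) :
    ((Matrix.of fun (i : Fin m) (p : Fin m × Fin K) => Polynomial.C (-(S p.2 i p.1))) *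
        (Matrix.of fun (p : Fin m × Fin K) (j : Fin m) => if p.1 = j then (X : R[X]) ^ d p.2 else 0)) i j
      = -((∑ l, (X : R[X]) ^ d l • (S l).map Polynomial.C) i j) := by
  simp only [Matrix.mul_apply, Matrix.of_apply, Fintype.sum_prod_type]
  rw [Finset.sum_eq_single j]
  · simp only [if_true, Matrix.sum_apply, Matrix.smul_apply, Matrix.map_apply, smul_eq_mul]
    rw [← Finset.sum_neg_distrib]
    exact Finset.sum_congr rfl fun l _ => by rw [Polynomial.C_neg]; ring
  · intro a _ ha
    simp [ha]
  · intro h; exact absurd (Finset.mem_univ j) h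

/-- **Schur-complement linearisation**: `det [[1, B], [C, 0]] = det (∑ l, X^{d l} • S l)` with `B = (X^{d p.2}·[p.1 = j])`,
`C = (−S p.2 i p.1)`. [folklore] -/
theorem det_linearization (d : Fin K → ℕ) (S : Fin K → Matrix (Fin m) (Fin m) R) :
    (Matrix.fromBlocks (1 : Matrix (Fin m × Fin K) (Fin m × Fin K) R[X])
        (Matrix.of fun (p : Fin m × Fin K) (j : Fin m) => if p.1 = j then (X : R[X]) ^ d p.2 else 0)
        (Matrix.of fun (i : Fin m) (p : Fin m × Fin K) => Polynomial.C (-(S p.2 i p.1)))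
        (0 : Matrix (Fin m) (Fin m) R[X])).det
      = (∑ l, (X : R[X]) ^ d l • (S l).map Polynomial.C).det := by
  rw [Matrix.det_fromBlocks_one₁₁, zero_sub]
  congr 1
  ext i j
  rw [Matrix.neg_apply, linBlocks_mul_apply, neg_neg]

/-- the explicit STATIC coefficient family of the linearisation (exponent `0` first, then `d`), written on the block index
type, sums to the block matrix `[[1, B], [C, 0]]`. [folklore] -/
theorem pencil_linCoeff (d : Fin K → ℕ) (S : Fin K → Matrix (Fin m) (Fin m) R) :
    (∑ l', (X : R[X]) ^ (Fin.cons 0 d : Fin (K + 1) → ℕ) l' •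
        ((Fin.cons (Matrix.fromBlocks (1 : Matrix (Fin m × Fin K) (Fin m × Fin K) R) 0
              (Matrix.of fun (i : Fin m) (p : Fin m × Fin K) => -(S p.2 i p.1)) (0 : Matrix (Fin m) (Fin m) R))
            (fun l : Fin K => Matrix.fromBlocks (0 : Matrix (Fin m × Fin K) (Fin m × Fin K) R)
              (Matrix.of fun (p : Fin m × Fin K) (j : Fin m) => if p.1 = j ∧ p.2 = l then (1 : R) else 0)
              0 (0 : Matrix (Fin m) (Fin m) R)) :
            Fin (K + 1) → Matrix ((Fin m × Fin K) ⊕ Fin m) ((Fin m × Fin K) ⊕ Fin m) R) l').map Polynomial.C)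
      = Matrix.fromBlocks (1 : Matrix (Fin m × Fin K) (Fin m × Fin K) R[X])
          (Matrix.of fun (p : Fin m × Fin K) (j : Fin m) => if p.1 = j then (X : R[X]) ^ d p.2 else 0)
          (Matrix.of fun (i : Fin m) (p : Fin m × Fin K) => Polynomial.C (-(S p.2 i p.1)))
          (0 : Matrix (Fin m) (Fin m) R[X]) := by
  refine Matrix.ext fun x y => ?_
  rw [Matrix.sum_apply, Fin.sum_univ_succ]
  simp only [Fin.cons_zero, Fin.cons_succ, pow_zero, Matrix.smul_apply, Matrix.map_apply, smul_eq_mul]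
  rcases x with p | i <;> rcases y with q | j
  · simp [Matrix.one_apply, apply_ite Polynomial.C]
  · simp only [Matrix.fromBlocks_apply₁₂, Matrix.zero_apply, Polynomial.C_0, mul_zero, zero_add, Matrix.of_apply,
      apply_ite Polynomial.C, Polynomial.C_1, Polynomial.C_0, mul_ite, mul_one, mul_zero]
    by_cases h : p.1 = j
    · simp only [h, true_and, if_true]
      rw [Finset.sum_ite_eq Finset.univ p.2 (fun l => (X : R[X]) ^ d l)]
      simp
    · simp [h]
  · simp
  · simp

/-- the linearisation coefficient family is STATIC: each entry position carries at most one exponent class. [folklore] -/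
theorem linCoeff_static (S : Fin K → Matrix (Fin m) (Fin m) R)
    (x y : (Fin m × Fin K) ⊕ Fin m) (l₁ l₂ : Fin (K + 1))
    (h₁ : (Fin.cons (Matrix.fromBlocks (1 : Matrix (Fin m × Fin K) (Fin m × Fin K) R) 0
              (Matrix.of fun (i : Fin m) (p : Fin m × Fin K) => -(S p.2 i p.1)) (0 : Matrix (Fin m) (Fin m) R))
            (fun l : Fin K => Matrix.fromBlocks (0 : Matrix (Fin m × Fin K) (Fin m × Fin K) R)
              (Matrix.of fun (p : Fin m × Fin K) (j : Fin m) => if p.1 = j ∧ p.2 = l then (1 : R) else 0)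
              0 (0 : Matrix (Fin m) (Fin m) R)) :
            Fin (K + 1) → Matrix ((Fin m × Fin K) ⊕ Fin m) ((Fin m × Fin K) ⊕ Fin m) R) l₁ x y ≠ 0)
    (h₂ : (Fin.cons (Matrix.fromBlocks (1 : Matrix (Fin m × Fin K) (Fin m × Fin K) R) 0
              (Matrix.of fun (i : Fin m) (p : Fin m × Fin K) => -(S p.2 i p.1)) (0 : Matrix (Fin m) (Fin m) R))
            (fun l : Fin K => Matrix.fromBlocks (0 : Matrix (Fin m × Fin K) (Fin m × Fin K) R)
              (Matrix.of fun (p : Fin m × Fin K) (j : Fin m) => if p.1 = j ∧ p.2 = l then (1 : R) else 0)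
              0 (0 : Matrix (Fin m) (Fin m) R)) :
            Fin (K + 1) → Matrix ((Fin m × Fin K) ⊕ Fin m) ((Fin m × Fin K) ⊕ Fin m) R) l₂ x y ≠ 0) :
    l₁ = l₂ := by
  induction l₁ using Fin.cases with
  | zero =>
    induction l₂ using Fin.cases with
    | zero => rfl
    | succ b =>
      exfalso
      simp only [Fin.cons_zero, Fin.cons_succ] at h₁ h₂
      rcases x with p | i <;> rcases y with q | j <;> simp at h₁ h₂
  | succ a =>
    induction l₂ using Fin.cases with
    | zero =>
      exfalso
      simp only [Fin.cons_zero, Fin.cons_succ] at h₁ h₂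
      rcases x with p | i <;> rcases y with q | j <;> simp at h₁ h₂
    | succ b =>
      simp only [Fin.cons_succ] at h₁ h₂
      rcases x with p | i <;> rcases y with q | j
      · simp at h₁
      · simp only [Matrix.fromBlocks_apply₁₂, Matrix.of_apply] at h₁ h₂
        by_cases c₁ : p.1 = j ∧ p.2 = a
        · by_cases c₂ : p.1 = j ∧ p.2 = b
          · rw [← c₁.2, ← c₂.2]
          · exact absurd (if_neg c₂) h₂
        · exact absurd (if_neg c₁) h₁
      · simp at h₁
      · simp at h₁

/-- **Static linearisation, existence form** (any commutative ring): for every `K`-term `m × m` pencil there is an explicit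
STATIC `(K+1)`-term pencil of size `m·K + m`, with exponents `(0, d)`, whose determinant is EQUAL to the original one. [folklore] -/
theorem exists_static_det_eq (d : Fin K → ℕ) (S : Fin K → Matrix (Fin m) (Fin m) R) :
    ∃ (d' : Fin (K + 1) → ℕ) (E : Fin (K + 1) → Matrix (Fin (m * K + m)) (Fin (m * K + m)) R),
      (∀ x y (l₁ l₂ : Fin (K + 1)), E l₁ x y ≠ 0 → E l₂ x y ≠ 0 → l₁ = l₂) ∧
      (∑ l', (X : R[X]) ^ d' l' • (E l').map Polynomial.C).det = (∑ l, (X : R[X]) ^ d l • (S l).map Polynomial.C).det := by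
  classical
  -- the block index type and its enumeration
  let e : (Fin m × Fin K) ⊕ Fin m ≃ Fin (m * K + m) := (Equiv.sumCongr finProdFinEquiv (Equiv.refl (Fin m))).trans finSumFinEquiv
  let T : Fin (K + 1) → Matrix ((Fin m × Fin K) ⊕ Fin m) ((Fin m × Fin K) ⊕ Fin m) R :=
    Fin.cons (Matrix.fromBlocks (1 : Matrix (Fin m × Fin K) (Fin m × Fin K) R) 0
        (Matrix.of fun (i : Fin m) (p : Fin m × Fin K) => -(S p.2 i p.1)) (0 : Matrix (Fin m) (Fin m) R))
      (fun l : Fin K => Matrix.fromBlocks (0 : Matrix (Fin m × Fin K) (Fin m × Fin K) R)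
        (Matrix.of fun (p : Fin m × Fin K) (j : Fin m) => if p.1 = j ∧ p.2 = l then (1 : R) else 0)
        0 (0 : Matrix (Fin m) (Fin m) R))
  refine ⟨Fin.cons 0 d, fun l' => Matrix.reindex e e (T l'), ?_, ?_⟩
  · intro x y l₁ l₂ h₁ h₂
    simp only [Matrix.reindex_apply, Matrix.submatrix_apply] at h₁ h₂
    exact linCoeff_static S (e.symm x) (e.symm y) l₁ l₂ h₁ h₂
  · have hre : (∑ l', (X : R[X]) ^ (Fin.cons 0 d : Fin (K + 1) → ℕ) l' • (Matrix.reindex e e (T l')).map Polynomial.C)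
        = Matrix.reindex e e (∑ l', (X : R[X]) ^ (Fin.cons 0 d : Fin (K + 1) → ℕ) l' • (T l').map Polynomial.C) := by
      refine Matrix.ext fun x y => ?_
      simp [Matrix.sum_apply]
    rw [hre, Matrix.det_reindex_self, pencil_linCoeff, det_linearization]

end Ring

/-! ## Row transfer over `ℝ` -/

section Rows

variable {m K : ℕ}

/-- **Static general rows bound general rows**: if every STATIC general real pencil of format `(m·K + m, K + 1)` has at most
`B` distinct real zeros of its determinant, then so does every general real pencil of format `(m, K)`. [folklore] -/
theorem genRootLawAt_of_static {B : ℕ}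
    (h : ∀ (d' : Fin (K + 1) → ℕ) (E : Fin (K + 1) → Matrix (Fin (m * K + m)) (Fin (m * K + m)) ℝ),
      (∀ x y (l₁ l₂ : Fin (K + 1)), E l₁ x y ≠ 0 → E l₂ x y ≠ 0 → l₁ = l₂) →
      (Matrix.det (∑ l, ((Polynomial.X : Polynomial ℝ) ^ d' l) • (E l).map Polynomial.C)).roots.toFinset.card ≤ B) :
    GenRootLawAt m K B := by
  intro d S
  obtain ⟨d', E, hst, hdet⟩ := exists_static_det_eq (R := ℝ) d S
  rw [← hdet]
  exact h d' E hst

/-- the same-`K` doubling `[[0, Eₗ], [Eₗᵀ, 0]]` (reindexed) of a STATIC family is STATIC. [folklore] -/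
theorem SD0_static {n K' : ℕ} (E : Fin K' → Matrix (Fin n) (Fin n) ℝ)
    (hE : ∀ x y (l₁ l₂ : Fin K'), E l₁ x y ≠ 0 → E l₂ x y ≠ 0 → l₁ = l₂) :
    ∀ x y (l₁ l₂ : Fin K'), SD0 E l₁ x y ≠ 0 → SD0 E l₂ x y ≠ 0 → l₁ = l₂ := by
  intro x y l₁ l₂ h₁ h₂
  simp only [SD0, BD0, Matrix.reindex_apply, Matrix.submatrix_apply] at h₁ h₂
  rcases hx : finSumFinEquiv.symm x with i | i <;> rcases hy : finSumFinEquiv.symm y with j | j <;>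
    rw [hx, hy] at h₁ h₂
  · simp at h₁
  · simp only [Matrix.fromBlocks_apply₁₂] at h₁ h₂
    exact hE i j l₁ l₂ h₁ h₂
  · simp only [Matrix.fromBlocks_apply₂₁, Matrix.transpose_apply] at h₁ h₂
    exact hE j i l₁ l₂ h₁ h₂
  · simp at h₁

/-- **Static symmetric rows bound general rows**: if every STATIC SYMMETRIC real pencil of format `((m·K+m) + (m·K+m), K + 1)`
has at most `B` distinct real zeros of its determinant, then so does every general real pencil of format `(m, K)`. [folklore] -/
theorem genRootLawAt_of_staticSymm {B : ℕ}
    (h : ∀ (d' : Fin (K + 1) → ℕ) (E : Fin (K + 1) → Matrix (Fin ((m * K + m) + (m * K + m))) (Fin ((m * K + m) + (m * K + m))) ℝ),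
      (∀ l, (E l).IsSymm) →
      (∀ x y (l₁ l₂ : Fin (K + 1)), E l₁ x y ≠ 0 → E l₂ x y ≠ 0 → l₁ = l₂) →
      (Matrix.det (∑ l, ((Polynomial.X : Polynomial ℝ) ^ d' l) • (E l).map Polynomial.C)).roots.toFinset.card ≤ B) :
    GenRootLawAt m K B := by
  intro d S
  obtain ⟨d', E, hst, hdet⟩ := exists_static_det_eq (R := ℝ) d S
  rw [← hdet, ← card_roots_SD0 d' E]
  exact h d' (SD0 E) (SD0_isSymm E) (SD0_static E hst)

/-- **Static symmetric rows bound symmetric rows** (the census currency `RealRootLawAt`). [folklore] -/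
theorem realRootLawAt_of_staticSymm {B : ℕ}
    (h : ∀ (d' : Fin (K + 1) → ℕ) (E : Fin (K + 1) → Matrix (Fin ((m * K + m) + (m * K + m))) (Fin ((m * K + m) + (m * K + m))) ℝ),
      (∀ l, (E l).IsSymm) →
      (∀ x y (l₁ l₂ : Fin (K + 1)), E l₁ x y ≠ 0 → E l₂ x y ≠ 0 → l₁ = l₂) →
      (Matrix.det (∑ l, ((Polynomial.X : Polynomial ℝ) ^ d' l) • (E l).map Polynomial.C)).roots.toFinset.card ≤ B) :
    RealRootLawAt m K B :=
  realRootLawAt_of_genRootLawAt (genRootLawAt_of_staticSymm h)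

/-- in particular a static symmetric ROW (all static symmetric pencils of the bigger format) transfers: the symmetric row at
format `(m, K)` is bounded by the FULL symmetric row at format `((m·K+m)+(m·K+m), K+1)` (weaker, hypothesis-free monotonicity
statement recorded for calibration). [folklore] -/
theorem realRootLawAt_of_realRootLawAt_lin {B : ℕ} (h : RealRootLawAt ((m * K + m) + (m * K + m)) (K + 1) B) :
    RealRootLawAt m K B :=
  realRootLawAt_of_staticSymm fun d' E hsy _ => h d' E hsy

end Rows

/-! ## Conjecture B is equivalent to its static symmetric restriction -/

/-- size arithmetic for the window case: with `L = ⌊log₂ m⌋`, `1 ≤ K` and `K + 1 ≤ m`, the linearised-and-doubled size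
`M = (m·K+m)+(m·K+m)` has `⌊log₂ M⌋ ≤ 2L + 2` and hence `C·((K+1) + ⌊log₂ M⌋²) ≤ 16·C·(K + L²)`. [folklore] -/
theorem lin_size_exponent_le (C m K : ℕ) (hK : 1 ≤ K) (hKm : K + 1 ≤ m) :
    C * ((K + 1) + Nat.log 2 ((m * K + m) + (m * K + m)) ^ 2) ≤ 16 * C * (K + Nat.log 2 m ^ 2) := by
  set L := Nat.log 2 m with hL
  have hm2 : 2 ≤ m := by omega
  have hL1 : 1 ≤ L := by
    rw [hL]; exact Nat.le_log_of_pow_le (by norm_num) (by simpa using hm2)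
  have hmlt : m < 2 ^ (L + 1) := Nat.lt_pow_succ_log_self one_lt_two m
  have hM : (m * K + m) + (m * K + m) < 2 ^ (2 * L + 3) := by
    have h1 : (m * K + m) + (m * K + m) = 2 * (m * (K + 1)) := by ring
    have h2 : m * (K + 1) ≤ m * m := Nat.mul_le_mul_left _ hKm
    have h3 : m * m < 2 ^ (L + 1) * 2 ^ (L + 1) := Nat.mul_lt_mul'' hmlt hmlt
    have h4 : 2 ^ (2 * L + 3) = 2 * (2 ^ (L + 1) * 2 ^ (L + 1)) := by
      rw [← pow_add, ← pow_succ']; congr 1; omega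
    omega
  have hlogM : Nat.log 2 ((m * K + m) + (m * K + m)) ≤ 2 * L + 2 := by
    have hne : (m * K + m) + (m * K + m) ≠ 0 := by positivity
    have := Nat.log_lt_of_lt_pow hne hM
    omega
  have hsq : Nat.log 2 ((m * K + m) + (m * K + m)) ^ 2 ≤ 16 * L ^ 2 := by
    calc Nat.log 2 ((m * K + m) + (m * K + m)) ^ 2 ≤ (2 * L + 2) ^ 2 := Nat.pow_le_pow_left hlogM 2
      _ ≤ 16 * L ^ 2 := by nlinarith
  calc C * ((K + 1) + Nat.log 2 ((m * K + m) + (m * K + m)) ^ 2) ≤ C * (2 * K + 16 * L ^ 2) :=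
        Nat.mul_le_mul_left _ (by omega)
    _ ≤ 16 * C * (K + L ^ 2) := by nlinarith

/-- fat cone `m ≤ K` (Descartes zone, no hypothesis): `RealRootLawAt m K (2^(2(K + ⌊log₂ m⌋²)))`, from the Descartes row
`2·C(m+K−1, m) − 1 ≤ 2^(m+K) ≤ 2^(2K)` (the `c = 0` case of `KPlusLogSqLaw.realRootLawAt_fatCone`, re-derived here to keep this
file off the route-file cone). [folklore] -/
theorem realRootLawAt_fatCone_zero (m K : ℕ) (hm : m ≤ K) : RealRootLawAt m K (2 ^ (2 * (K + Nat.log 2 m ^ 2))) := by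
  rcases Nat.eq_zero_or_pos K with rfl | hK0
  · exact realRootLawAt_zero m _
  refine realRootLawAt_mono ?_ (realRootLawAt_descartes m K hK0)
  have h1 : Nat.choose (m + K - 1) m ≤ 2 ^ (m + K - 1) := Nat.choose_le_two_pow _ _
  have h2 : 2 * 2 ^ (m + K - 1) = 2 ^ (m + K) := by
    rw [← pow_succ']; congr 1; omega
  have h3 : 2 ^ (m + K) ≤ 2 ^ (2 * (K + Nat.log 2 m ^ 2)) := Nat.pow_le_pow_right two_pos (by nlinarith)
  omega

/-- **Conjecture B ⟺ Conjecture B for STATIC SYMMETRIC pencils** (monomial-entry real symmetric matrices: every entry of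
`∑ l, X^{d l} • E l` is a single signed monomial).  `→` is restriction; `←`: off the fat cone (`m ≤ K`) Conjecture B is a Descartes
theorem (`realRootLawAt_fatCone_zero`), and for `K < m` the row at `(m, K)` is bounded by the static symmetric rows at
`((m·K+m)+(m·K+m), K+1)` (`realRootLawAt_of_staticSymm`) whose budget exponent is at most `16·C·(K + ⌊log₂ m⌋²)`
(`lin_size_exponent_le`).  An EQUIVALENCE between two OPEN statements; neither side is asserted. [folklore] -/
theorem kPlusLogSqLaw_iff_staticSymm :
    KPlusLogSqLaw ↔ ∃ C : ℕ, ∀ (n K' : ℕ) (d : Fin K' → ℕ) (E : Fin K' → Matrix (Fin n) (Fin n) ℝ),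
      (∀ l, (E l).IsSymm) → (∀ x y (l₁ l₂ : Fin K'), E l₁ x y ≠ 0 → E l₂ x y ≠ 0 → l₁ = l₂) →
      (Matrix.det (∑ l, ((Polynomial.X : Polynomial ℝ) ^ d l) • (E l).map Polynomial.C)).roots.toFinset.card
        ≤ 2 ^ (C * (K' + Nat.log 2 n ^ 2)) := by
  constructor
  · rintro ⟨C, hC⟩
    exact ⟨C, fun n K' d E hsy _ => hC n K' d E hsy⟩
  · rintro ⟨C, hC⟩
    refine ⟨16 * C + 2, fun m K => ?_⟩
    rcases Nat.eq_zero_or_pos K with rfl | hK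
    · exact realRootLawAt_zero m _
    by_cases hmK : m ≤ K
    · -- fat cone `m ≤ 2^0 · K`: Descartes
      refine realRootLawAt_mono ?_ (realRootLawAt_fatCone_zero m K hmK)
      exact Nat.pow_le_pow_right two_pos (Nat.mul_le_mul_right _ (by omega))
    · -- window side `K < m`: static symmetric rows at the linearised-and-doubled format
      have hKm : K + 1 ≤ m := by omega
      refine realRootLawAt_mono ?_ (realRootLawAt_of_staticSymm fun d' E hsy hst => hC _ _ d' E hsy hst)
      refine Nat.pow_le_pow_right two_pos ?_
      calc C * (K + 1 + Nat.log 2 ((m * K + m) + (m * K + m)) ^ 2) ≤ 16 * C * (K + Nat.log 2 m ^ 2) :=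
            lin_size_exponent_le C m K hK hKm
        _ ≤ (16 * C + 2) * (K + Nat.log 2 m ^ 2) := Nat.mul_le_mul_right _ (by omega)

end Summit.ValiantsHypothesis.ValiantsHypothesis.Theorems.KPlusLogSqLaw.RealStatic
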